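import Literature.Barriers.QuantumFields.FiniteTemperatureSpatialReflectionBlocks
import HarnessLib

/-!
# Reflection positivity of the finite-temperature Wilson weight in spatial bond and site planes

Third of three theorem-only files on spatial reflection positivity for the finite-temperature
Wilson lattice gauge theory on `ℤ_{L₀} × (ℤ/(2n+2))^d` (see `FiniteTemperatureSpatialReflection`,
`FiniteTemperatureSpatialReflectionBlocks`). The two theorems (continuous unitary `ρ`):

* `integral_mul_conj_spaceReflect_mul_weight_nonneg` — **RP in the bond planes** `x_i = 1/2`,
  `x_i = (L+1)/2` (`J_E, J_M ≥ 0`): `0 ≤ ∫ O(U) conj(O(θU)) e^{−S(U)} ∏dg` for every bounded measurable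
  observable `O` depending only on the links based in the half `{x_i ∈ {0,−1,…,−n}}` minus the
  crossing links;
* `integral_mul_conj_spaceSiteReflect_mul_weight_nonneg` — **RP in the lattice planes** `x_i = 0`,
  `x_i = L/2` (`n ≥ 1`): the same with `σ` and observables depending on the closed half.

Mechanism (Osterwalder–Seiler; the tree's abstract theorems
`LatticeRP.integral_mul_conj_mul_exp_nonneg` and `LatticeRP.integral_splice_mul_conj_comp_of_shared_nonneg`):
for the bond reflection the crossing links are RANDOMISED — `mulOn2` multiplies the direction-`i`
links across the bond `(0,1)` on the left and those across `(n+1,n+2)` on the right by independent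
Haar variables `Y` (`integral_eq_integral_prod_mulOn2`, left and right invariance of the Haar
probability measure) — after which every crossing plaquette is a Gram pairing of a feature of
`z = splice C (U, Y)` with the same feature of `θU`: with `M(U')(y,μ) = U'(y,i)⁻¹U'(y,μ)U'(y+μ,i)`
(`featM`, bond `(0,1)`) and `N(U')(y,μ) = U'(y,i)U'(y+e_i,μ)U'(y+μ,i)⁻¹` (`featN`, bond `(n+1,n+2)`),
`tr ρ(W_P) = tr(ρ(F(z))ᴴ ρ(F(θU)))` (`trace_plaquette_mulOn2_cross0/1`), so that
`e^{−S(W)} = e^{A(z)} e^{A(θU)} exp(Σ_I a_I(z) conj a_I(θU))` (`weight_mulOn2`, `sum_aBond_mul_conj`)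
with the explicit Gram families `aEl`, `aMag` (entries and conjugate entries of `ρ(F)`, scaled by
`√(J/2)`). For the site reflection no link crosses the planes and the in-plane plaquettes are
shared and `σ`-invariant.

References: C. Borgs, E. Seiler, Commun. Math. Phys. 91 (1983) 329–380, §II.2 (pp. 331–332:
"reflection positivity with respect to reflection both in lattice planes and in planes lying
half-way between lattice planes"), §III.2 (p. 348); K. Osterwalder, E. Seiler, Ann. Phys. 110 (1978)
440, §2; J. Fröhlich, R. Israel, E. H. Lieb, B. Simon, Commun. Math. Phys. 62 (1978) 1, Thm 2.1.
[BorgsSeiler1983] [FrohlichEtAl1978]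
-/

noncomputable section

open MeasureTheory Filter Topology
open scoped ComplexConjugate ComplexOrder

namespace Literature.Barriers.QuantumFields

namespace FiniteTemperature

open Literature.MathematicalPhysics.QuantumFieldTheory.LatticeRP (splice splice_apply piMeasure)

section Cross

variable {d L₀ n : ℕ} [NeZero L₀] {G : Type*} [Group G] {N : ℕ}
variable (ρ : G →* Matrix (Fin N) (Fin N) ℂ)

/-! #### The two crossing bonds and the left/right randomisation -/

variable (d L₀ n) in
/-- Crossing links of the bond `(0, 1)`: direction-`i` links based in the slice `0`. [folklore] -/
def cross0 (i : Fin d) : Finset (Site d L₀ (2 * n + 2) × Dir d) :=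
  Finset.univ.filter fun e => e.2 = some i ∧ e.1.2 i = 0

variable (d L₀ n) in
/-- Crossing links of the bond `(n+1, n+2)`: direction-`i` links based in the slice `n + 1`. [folklore] -/
def cross1 (i : Fin d) : Finset (Site d L₀ (2 * n + 2) × Dir d) :=
  Finset.univ.filter fun e => e.2 = some i ∧ e.1.2 i = ((n + 1 : ℕ) : ZMod (2 * n + 2))

/-- Membership in the first crossing block. [folklore] -/
@[simp] theorem mem_cross0 {i : Fin d} {e : Site d L₀ (2 * n + 2) × Dir d} :
    e ∈ cross0 d L₀ n i ↔ e.2 = some i ∧ e.1.2 i = 0 := by simp [cross0]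

/-- Membership in the second crossing block. [folklore] -/
@[simp] theorem mem_cross1 {i : Fin d} {e : Site d L₀ (2 * n + 2) × Dir d} :
    e ∈ cross1 d L₀ n i ↔ e.2 = some i ∧ e.1.2 i = ((n + 1 : ℕ) : ZMod (2 * n + 2)) := by simp [cross1]

omit [NeZero L₀] in
/-- `0 ≠ n + 1` in `ℤ_{2n+2}`. [folklore] -/
theorem zero_ne_half : (0 : ZMod (2 * n + 2)) ≠ ((n + 1 : ℕ) : ZMod (2 * n + 2)) := by
  intro h
  have := congrArg ZMod.val h
  rw [ZMod.val_zero, val_natCast_half] at this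
  omega

/-- The crossing block is the union of the two bonds' crossing links. [folklore] -/
theorem bondCross_eq (i : Fin d) : bondCross d L₀ n i = cross0 d L₀ n i ∪ cross1 d L₀ n i := by
  ext e; simp [and_or_left]

/-- The two crossing blocks are disjoint. [folklore] -/
theorem not_mem_cross1_of_mem_cross0 {i : Fin d} {e : Site d L₀ (2 * n + 2) × Dir d}
    (he : e ∈ cross0 d L₀ n i) : e ∉ cross1 d L₀ n i := by
  rw [mem_cross0] at he; rw [mem_cross1]
  rintro ⟨-, h⟩; exact zero_ne_half (he.2.symm.trans h)

/-- The two crossing blocks are disjoint. [folklore] -/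
theorem not_mem_cross0_of_mem_cross1 {i : Fin d} {e : Site d L₀ (2 * n + 2) × Dir d}
    (he : e ∈ cross1 d L₀ n i) : e ∉ cross0 d L₀ n i := fun h =>
  not_mem_cross1_of_mem_cross0 h he

/-- **Left/right randomisation of the crossing links**: multiply the crossing links of the bond
`(0,1)` on the LEFT and those of the bond `(n+1, n+2)` on the RIGHT by the corresponding coordinates
of `Y` (the side on which the random factor sits is the side of the positive half `A ∋ 0, n+2`).
[folklore] -/
def mulOn2 (i : Fin d) (Y U : Config d L₀ (2 * n + 2) G) : Config d L₀ (2 * n + 2) G :=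
  fun e => (if e ∈ cross0 d L₀ n i then Y e else 1) * U e * (if e ∈ cross1 d L₀ n i then Y e else 1)

/-- `mulOn2` on the first crossing block: left multiplication. [folklore] -/
theorem mulOn2_apply_of_mem_cross0 {i : Fin d} (Y U : Config d L₀ (2 * n + 2) G)
    {e : Site d L₀ (2 * n + 2) × Dir d} (he : e ∈ cross0 d L₀ n i) : mulOn2 i Y U e = Y e * U e := by
  simp [mulOn2, he, not_mem_cross1_of_mem_cross0 he]

/-- `mulOn2` on the second crossing block: right multiplication. [folklore] -/
theorem mulOn2_apply_of_mem_cross1 {i : Fin d} (Y U : Config d L₀ (2 * n + 2) G)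
    {e : Site d L₀ (2 * n + 2) × Dir d} (he : e ∈ cross1 d L₀ n i) : mulOn2 i Y U e = U e * Y e := by
  simp [mulOn2, he, not_mem_cross0_of_mem_cross1 he]

/-- `mulOn2` off the crossing blocks. [folklore] -/
theorem mulOn2_apply_of_not_mem {i : Fin d} (Y U : Config d L₀ (2 * n + 2) G)
    {e : Site d L₀ (2 * n + 2) × Dir d} (h0 : e ∉ cross0 d L₀ n i) (h1 : e ∉ cross1 d L₀ n i) :
    mulOn2 i Y U e = U e := by
  simp [mulOn2, h0, h1]

/-- A non-`i` link is not randomised. [folklore] -/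
theorem mulOn2_apply_of_ne {i : Fin d} (Y U : Config d L₀ (2 * n + 2) G) (s : Site d L₀ (2 * n + 2))
    {μ : Dir d} (hμ : μ ≠ some i) : mulOn2 i Y U (s, μ) = U (s, μ) :=
  mulOn2_apply_of_not_mem Y U (fun h => hμ (mem_cross0.1 h).1) (fun h => hμ (mem_cross1.1 h).1)

variable [TopologicalSpace G] [IsTopologicalGroup G] [CompactSpace G] [MeasurableSpace G]
  [BorelSpace G] [SecondCountableTopology G]

omit ρ [SecondCountableTopology G] in
/-- For fixed `Y`, `U ↦ mulOn2 i Y U` preserves the a-priori measure (left and right invariance of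
the Haar probability measure, factor by factor). [folklore] -/
theorem measurePreserving_mulOn2 (i : Fin d) (Y : Config d L₀ (2 * n + 2) G) :
    MeasurePreserving (mulOn2 i Y) (haar d L₀ (2 * n + 2) G) (haar d L₀ (2 * n + 2) G) := by
  unfold haar mulOn2
  exact measurePreserving_pi
    (f := fun (e : Site d L₀ (2 * n + 2) × Dir d) (g : G) =>
      (if e ∈ cross0 d L₀ n i then Y e else 1) * g * (if e ∈ cross1 d L₀ n i then Y e else 1))
    (fun _ : Site d L₀ (2 * n + 2) × Dir d => Literature.MathematicalPhysics.QuantumFieldTheory.haarProbability G)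
    (fun _ : Site d L₀ (2 * n + 2) × Dir d => Literature.MathematicalPhysics.QuantumFieldTheory.haarProbability G)
    fun e => (measurePreserving_mul_right (Literature.MathematicalPhysics.QuantumFieldTheory.haarProbability G) _).comp
      (measurePreserving_mul_left (Literature.MathematicalPhysics.QuantumFieldTheory.haarProbability G) _)

omit ρ in
/-- **Randomisation of the crossing links.** For a bounded measurable `F`,
`∫ F dμ = ∫∫ F(mulOn2 Y U) dμ(U) dμ(Y)`. [folklore] -/
theorem integral_eq_integral_prod_mulOn2 (i : Fin d)
    {F : Config d L₀ (2 * n + 2) G → ℂ} (hFm : Measurable F) {K : ℝ} (hFb : ∀ U, ‖F U‖ ≤ K) :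
    ∫ U, F U ∂haar d L₀ (2 * n + 2) G =
      ∫ p : Config d L₀ (2 * n + 2) G × Config d L₀ (2 * n + 2) G, F (mulOn2 i p.2 p.1)
        ∂(haar d L₀ (2 * n + 2) G).prod (haar d L₀ (2 * n + 2) G) := by
  have hm : Measurable fun p : Config d L₀ (2 * n + 2) G × Config d L₀ (2 * n + 2) G => mulOn2 i p.2 p.1 := by
    refine measurable_pi_lambda _ fun e => ?_
    simp only [mulOn2]
    refine Measurable.mul (Measurable.mul ?_ ((measurable_pi_apply e).comp measurable_fst)) ?_
    · split_ifs
      · exact (measurable_pi_apply e).comp measurable_snd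
      · exact measurable_const
    · split_ifs
      · exact (measurable_pi_apply e).comp measurable_snd
      · exact measurable_const
  have hi : Integrable (fun p : Config d L₀ (2 * n + 2) G × Config d L₀ (2 * n + 2) G => F (mulOn2 i p.2 p.1))
      ((haar d L₀ (2 * n + 2) G).prod (haar d L₀ (2 * n + 2) G)) :=
    Integrable.of_bound (hFm.comp hm).aestronglyMeasurable K (ae_of_all _ fun p => hFb _)
  rw [integral_prod_symm _ hi]
  have hY : ∀ Y : Config d L₀ (2 * n + 2) G,
      ∫ U, F (mulOn2 i Y U) ∂haar d L₀ (2 * n + 2) G = ∫ U, F U ∂haar d L₀ (2 * n + 2) G :=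
    fun Y => Literature.MathematicalPhysics.QuantumFieldTheory.LatticeRP.integral_comp_eq_of_measurePreserving
      (measurePreserving_mulOn2 i Y) hFm
  simp_rw [hY]
  rw [integral_const, probReal_univ, one_smul]

/-! #### The Gram features of the crossing plaquettes -/

omit [TopologicalSpace G] [IsTopologicalGroup G] [CompactSpace G] [MeasurableSpace G] [BorelSpace G]
  [SecondCountableTopology G]

/-- **Feature of the bond `(0,1)`**: `M(U')(y, μ) = U'(y,i)⁻¹ U'(y,μ) U'(y + μ, i)` (group valued). At
`z = splice C (U, Y)` it reads `Y_y⁻¹ s_y Y_{y+μ}` (random factors and a positive-side link); at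
`θU` it reads `v_y s'_{y+e_i} v_{y+μ}⁻¹` (crossing links and a negative-side link). [folklore] -/
def featM {L : ℕ} (i : Fin d) (U' : Config d L₀ L G) (y : Site d L₀ L) (μ : Dir d) : G :=
  (U' (y, some i))⁻¹ * U' (y, μ) * U' (y.shift μ, some i)

/-- **Feature of the bond `(n+1, n+2)`**: `N(U')(y, μ) = U'(y,i) U'(y + e_i, μ) U'(y + μ, i)⁻¹`. [folklore] -/
def featN {L : ℕ} (i : Fin d) (U' : Config d L₀ L G) (y : Site d L₀ L) (μ : Dir d) : G :=
  U' (y, some i) * U' (y.shift (some i), μ) * (U' (y.shift μ, some i))⁻¹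

omit [NeZero L₀] in
/-- `M(θU) = N(U)` on the slice `0`. [folklore] -/
theorem featM_spaceReflect (i : Fin d) (U : Config d L₀ (2 * n + 2) G) {y : Site d L₀ (2 * n + 2)}
    (hy : y.2 i = 0) {μ : Dir d} (hμ : μ ≠ some i) :
    featM i (spaceReflect i U) y μ = featN i U y μ := by
  rcases y with ⟨t, x⟩
  have hσ : siteRefl i x = x := by
    funext j; by_cases hj : j = i
    · subst hj; simp only at hy; rw [siteRefl_apply_same, hy, neg_zero]
    · rw [siteRefl_apply_of_ne hj]
  have hθ : bondRefl i x = x + Pi.single i 1 := by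
    rw [← siteRefl_add_single, hσ]
  unfold featM featN
  rw [spaceReflect_same, spaceReflect_apply_of_ne i U (t, x) hμ, inv_inv]
  have h3 : spaceReflect i U (Site.shift (t, x) μ, some i) = (U (Site.shift (t, x) μ, some i))⁻¹ := by
    rcases μ with _ | k
    · simp only [Site.shift, spaceReflect_same, hσ]
    · have hk : k ≠ i := fun h => hμ (by rw [h])
      simp only [Site.shift, spaceReflect_same, siteRefl_add_single_of_ne hk, hσ]
  rw [h3]
  simp only [hσ, hθ, Site.shift]

omit [NeZero L₀] in
/-- `N(θU) = M(U)` on the slice `n + 1`. [folklore] -/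
theorem featN_spaceReflect (i : Fin d) (U : Config d L₀ (2 * n + 2) G) {y : Site d L₀ (2 * n + 2)}
    (hy : y.2 i = ((n + 1 : ℕ) : ZMod (2 * n + 2))) {μ : Dir d} (hμ : μ ≠ some i) :
    featN i (spaceReflect i U) y μ = featM i U y μ := by
  rcases y with ⟨t, x⟩
  have hσ : siteRefl i x = x := by
    funext j; by_cases hj : j = i
    · subst hj; simp only at hy; rw [siteRefl_apply_same, hy, neg_half]
    · rw [siteRefl_apply_of_ne hj]
  unfold featM featN
  rw [spaceReflect_same, hσ]
  have h2 : spaceReflect i U (Site.shift (t, x) (some i), μ) = U ((t, x), μ) := by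
    rw [spaceReflect_apply_of_ne i U _ hμ]
    simp only [Site.shift, bondRefl_add_single, hσ]
  have h3 : spaceReflect i U (Site.shift (t, x) μ, some i) = (U (Site.shift (t, x) μ, some i))⁻¹ := by
    rcases μ with _ | k
    · simp only [Site.shift, spaceReflect_same, hσ]
    · have hk : k ≠ i := fun h => hμ (by rw [h])
      simp only [Site.shift, spaceReflect_same, siteRefl_add_single_of_ne hk, hσ]
  rw [h2, h3, inv_inv]

/-- `M(z)` for `z = splice C (U, Y)` on the slice `0`: `Y_y⁻¹ U(y,μ) Y_{y+μ}`. [folklore] -/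
theorem featM_splice (i : Fin d) (U Y : Config d L₀ (2 * n + 2) G) {y : Site d L₀ (2 * n + 2)}
    (hy : y.2 i = 0) {μ : Dir d} (hμ : μ ≠ some i) :
    featM i (splice (bondCross d L₀ n i) (U, Y)) y μ =
      (Y (y, some i))⁻¹ * U (y, μ) * Y (y.shift μ, some i) := by
  unfold featM
  rw [splice_apply, if_pos (by rw [mem_bondCross]; exact ⟨rfl, Or.inl hy⟩), splice_apply,
    if_neg (by rw [mem_bondCross]; exact fun h => hμ h.1), splice_apply,
    if_pos (by rw [mem_bondCross]; exact ⟨rfl, Or.inl (by rw [shift_apply_dir_of_ne y i hμ, hy])⟩)]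

/-- `N(z)` on the slice `n + 1`: `Y_y U(y+e_i,μ) Y_{y+μ}⁻¹`. [folklore] -/
theorem featN_splice (i : Fin d) (U Y : Config d L₀ (2 * n + 2) G) {y : Site d L₀ (2 * n + 2)}
    (hy : y.2 i = ((n + 1 : ℕ) : ZMod (2 * n + 2))) {μ : Dir d} (hμ : μ ≠ some i) :
    featN i (splice (bondCross d L₀ n i) (U, Y)) y μ =
      Y (y, some i) * U (y.shift (some i), μ) * (Y (y.shift μ, some i))⁻¹ := by
  unfold featN
  rw [splice_apply, if_pos (by rw [mem_bondCross]; exact ⟨rfl, Or.inr hy⟩), splice_apply,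
    if_neg (by rw [mem_bondCross]; exact fun h => hμ h.1), splice_apply,
    if_pos (by rw [mem_bondCross]; exact ⟨rfl, Or.inr (by rw [shift_apply_dir_of_ne y i hμ, hy])⟩)]

/-- **Crossing plaquettes of the bond `(0,1)` after randomisation**: for `y` in the slice `0` and
`μ ≠ i`, `tr ρ(W_P(y; i, μ)) = tr(ρ(M(z))ᴴ ρ(M(θU)))`, `W = mulOn2 Y U`. [folklore] -/
theorem trace_plaquette_mulOn2_cross0 (hρu : ∀ g, ρ g ∈ Matrix.unitaryGroup (Fin N) ℂ) (i : Fin d)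
    (U Y : Config d L₀ (2 * n + 2) G) {y : Site d L₀ (2 * n + 2)} (hy : y.2 i = 0) {μ : Dir d}
    (hμ : μ ≠ some i) :
    (ρ (plaquette (mulOn2 i Y U) y (some i) μ)).trace =
      (star (ρ (featM i (splice (bondCross d L₀ n i) (U, Y)) y μ)) * ρ (featM i (spaceReflect i U) y μ)).trace := by
  rw [featM_splice i U Y hy hμ, featM_spaceReflect i U hy hμ]
  unfold plaquette featN
  have h1 : mulOn2 i Y U (y, some i) = Y (y, some i) * U (y, some i) :=
    mulOn2_apply_of_mem_cross0 Y U (mem_cross0.2 ⟨rfl, hy⟩)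
  have h2 : mulOn2 i Y U (y.shift (some i), μ) = U (y.shift (some i), μ) := mulOn2_apply_of_ne Y U _ hμ
  have h3 : mulOn2 i Y U (y.shift μ, some i) = Y (y.shift μ, some i) * U (y.shift μ, some i) :=
    mulOn2_apply_of_mem_cross0 Y U (mem_cross0.2 ⟨rfl, by rw [shift_apply_dir_of_ne y i hμ, hy]⟩)
  have h4 : mulOn2 i Y U (y, μ) = U (y, μ) := mulOn2_apply_of_ne Y U _ hμ
  rw [h1, h2, h3, h4]
  simp only [map_mul, rep_inv_eq_star ρ hρu, mul_inv_rev, star_mul, star_star, Matrix.mul_assoc]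
  conv_lhs => rw [Matrix.trace_mul_comm]; simp only [Matrix.mul_assoc]
  conv_lhs => rw [Matrix.trace_mul_comm]; simp only [Matrix.mul_assoc]
  conv_lhs => rw [Matrix.trace_mul_comm]; simp only [Matrix.mul_assoc]
  conv_lhs => rw [Matrix.trace_mul_comm]; simp only [Matrix.mul_assoc]

end Cross

section Cross2

variable {d L₀ n : ℕ} [NeZero L₀] {G : Type*} [Group G] {N : ℕ}
variable (ρ : G →* Matrix (Fin N) (Fin N) ℂ)

/-- **Crossing plaquettes of the bond `(n+1,n+2)` after randomisation**: for `y` in the slice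
`n + 1` and `μ ≠ i`, `tr ρ(W_P(y; μ, i)) = tr(ρ(N(z))ᴴ ρ(N(θU)))`. [folklore] -/
theorem trace_plaquette_mulOn2_cross1 (hρu : ∀ g, ρ g ∈ Matrix.unitaryGroup (Fin N) ℂ) (i : Fin d)
    (U Y : Config d L₀ (2 * n + 2) G) {y : Site d L₀ (2 * n + 2)}
    (hy : y.2 i = ((n + 1 : ℕ) : ZMod (2 * n + 2))) {μ : Dir d} (hμ : μ ≠ some i) :
    (ρ (plaquette (mulOn2 i Y U) y μ (some i))).trace =
      (star (ρ (featN i (splice (bondCross d L₀ n i) (U, Y)) y μ)) * ρ (featN i (spaceReflect i U) y μ)).trace := by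
  rw [featN_splice i U Y hy hμ, featN_spaceReflect i U hy hμ]
  unfold plaquette featM
  have h1 : mulOn2 i Y U (y, some i) = U (y, some i) * Y (y, some i) :=
    mulOn2_apply_of_mem_cross1 Y U (mem_cross1.2 ⟨rfl, hy⟩)
  have h2 : mulOn2 i Y U (y.shift (some i), μ) = U (y.shift (some i), μ) := mulOn2_apply_of_ne Y U _ hμ
  have h3 : mulOn2 i Y U (y.shift μ, some i) = U (y.shift μ, some i) * Y (y.shift μ, some i) :=
    mulOn2_apply_of_mem_cross1 Y U (mem_cross1.2 ⟨rfl, by rw [shift_apply_dir_of_ne y i hμ, hy]⟩)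
  have h4 : mulOn2 i Y U (y, μ) = U (y, μ) := mulOn2_apply_of_ne Y U _ hμ
  rw [h1, h2, h3, h4]
  simp only [map_mul, rep_inv_eq_star ρ hρu, mul_inv_rev, star_mul, star_star, Matrix.mul_assoc]
  conv_lhs => rw [Matrix.trace_mul_comm]; simp only [Matrix.mul_assoc]
  conv_lhs => rw [Matrix.trace_mul_comm]; simp only [Matrix.mul_assoc]

/-- The feature of the bond `b`: `M` for `b = false` (bond `(0,1)`), `N` for `b = true` (bond
`(n+1, n+2)`). [folklore] -/
def feat {L : ℕ} (i : Fin d) (U' : Config d L₀ L G) (y : Site d L₀ L) (μ : Dir d) : Bool → G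
  | false => featM i U' y μ
  | true => featN i U' y μ

variable (n) in
/-- The slice of the bond `b`: `0` or `n + 1`. [folklore] -/
abbrev bondSlice : Bool → ZMod (2 * n + 2)
  | false => 0
  | true => ((n + 1 : ℕ) : ZMod (2 * n + 2))

/-- The other direction of an unordered pair containing `i`. [folklore] -/
def otherDir (i : Fin d) (p : {p : Fin d × Fin d // p.1 < p.2}) : Fin d := if p.1.1 = i then p.1.2 else p.1.1

omit [NeZero L₀] in
/-- `Re tr ρ(P⁻¹) = Re tr ρ(P)` packaged for plaquettes with reversed orientation. [folklore] -/
theorem trace_re_plaquette_swap {L : ℕ} (hρu : ∀ g, ρ g ∈ Matrix.unitaryGroup (Fin N) ℂ)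
    (U' : Config d L₀ L G) (y : Site d L₀ L) (μ ν : Dir d) :
    (ρ (plaquette U' y ν μ)).trace.re = (ρ (plaquette U' y μ ν)).trace.re := by
  rw [plaquette_swap, trace_re_rep_inv ρ hρu]

/-- **Electric crossing plaquettes after randomisation, real parts**: for `y` in the slice of the
bond `b`, `Re tr ρ(W_P(y; time, i)) = Re tr(ρ(F_b(z))ᴴ ρ(F_b(θU)))`. [folklore] -/
theorem re_trace_plaquette_mulOn2_elec (hρu : ∀ g, ρ g ∈ Matrix.unitaryGroup (Fin N) ℂ) (i : Fin d)
    (U Y : Config d L₀ (2 * n + 2) G) (b : Bool) {y : Site d L₀ (2 * n + 2)} (hy : y.2 i = bondSlice n b) :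
    (ρ (plaquette (mulOn2 i Y U) y none (some i))).trace.re =
      ((star (ρ (feat i (splice (bondCross d L₀ n i) (U, Y)) y none b)) *
        ρ (feat i (spaceReflect i U) y none b)).trace).re := by
  cases b with
  | false =>
      rw [trace_re_plaquette_swap ρ hρu, trace_plaquette_mulOn2_cross0 ρ hρu i U Y hy (by simp)]
      rfl
  | true =>
      rw [trace_plaquette_mulOn2_cross1 ρ hρu i U Y hy (by simp)]
      rfl

/-- **Magnetic crossing plaquettes after randomisation, real parts**: for `y` in the slice of the
bond `b` and a pair `p ∋ i`, `Re tr ρ(W_P(y; p)) = Re tr(ρ(F_b(z)(y, k))ᴴ ρ(F_b(θU)(y, k)))`, `k`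
the other direction of `p`. [folklore] -/
theorem re_trace_plaquette_mulOn2_mag (hρu : ∀ g, ρ g ∈ Matrix.unitaryGroup (Fin N) ℂ) (i : Fin d)
    (U Y : Config d L₀ (2 * n + 2) G) (b : Bool) {y : Site d L₀ (2 * n + 2)} (hy : y.2 i = bondSlice n b)
    {p : {p : Fin d × Fin d // p.1 < p.2}} (hp : ¬(p.1.1 ≠ i ∧ p.1.2 ≠ i)) :
    (ρ (plaquette (mulOn2 i Y U) y (some p.1.1) (some p.1.2))).trace.re =
      ((star (ρ (feat i (splice (bondCross d L₀ n i) (U, Y)) y (some (otherDir i p)) b)) *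
        ρ (feat i (spaceReflect i U) y (some (otherDir i p)) b)).trace).re := by
  by_cases h1 : p.1.1 = i
  · have h2 : p.1.2 ≠ i := by
      intro h2; have := p.2; rw [h1, h2] at this; exact lt_irrefl _ this
    simp only [otherDir, h1, if_true]
    cases b with
    | false =>
        rw [trace_plaquette_mulOn2_cross0 ρ hρu i U Y hy (by simpa using h2)]
        rfl
    | true =>
        rw [trace_re_plaquette_swap ρ hρu, trace_plaquette_mulOn2_cross1 ρ hρu i U Y hy (by simpa using h2)]
        rfl
  · have h2 : p.1.2 = i := by by_contra h2; exact hp ⟨h1, h2⟩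
    simp only [otherDir, h1, if_false, h2]
    cases b with
    | false =>
        rw [trace_re_plaquette_swap ρ hρu, trace_plaquette_mulOn2_cross0 ρ hρu i U Y hy (by simpa using h1)]
        rfl
    | true =>
        rw [trace_plaquette_mulOn2_cross1 ρ hρu i U Y hy (by simpa using h1)]
        rfl

/-! #### Gram families and their sums -/

/-- The electric Gram family of the bond `b`: entries (and conjugate entries) of `ρ(F_b(U')(y, time))`
for `y` in the slice of the bond, scaled by `√(J_E/2)`; zero elsewhere. [folklore] -/
def aEl (JE : ℝ) (i : Fin d) (b : Bool) :
    (Site d L₀ (2 * n + 2) × Fin N × Fin N) × Bool → Config d L₀ (2 * n + 2) G → ℂ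
  | ((y, k, l), false) => fun U' => if y.2 i = bondSlice n b then
      (Real.sqrt (JE / 2) : ℂ) * ρ (feat i U' y none b) k l else 0
  | ((y, k, l), true) => fun U' => if y.2 i = bondSlice n b then
      (Real.sqrt (JE / 2) : ℂ) * conj (ρ (feat i U' y none b) k l) else 0

/-- The magnetic Gram family (both bonds): entries of `ρ(F_b(U')(y, k_p))` for `y` in the slice of the
bond `b` and pairs `p ∋ i`, scaled by `√(J_M/2)`; zero elsewhere. [folklore] -/
def aMag (JM : ℝ) (i : Fin d) :
    (Bool × Site d L₀ (2 * n + 2) × {p : Fin d × Fin d // p.1 < p.2} × Fin N × Fin N) × Bool →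
      Config d L₀ (2 * n + 2) G → ℂ
  | ((b, y, p, k, l), false) => fun U' => if y.2 i = bondSlice n b ∧ ¬(p.1.1 ≠ i ∧ p.1.2 ≠ i) then
      (Real.sqrt (JM / 2) : ℂ) * ρ (feat i U' y (some (otherDir i p)) b) k l else 0
  | ((b, y, p, k, l), true) => fun U' => if y.2 i = bondSlice n b ∧ ¬(p.1.1 ≠ i ∧ p.1.2 ≠ i) then
      (Real.sqrt (JM / 2) : ℂ) * conj (ρ (feat i U' y (some (otherDir i p)) b) k l) else 0

/-- The electric Gram sum of the bond `b`: `J_E Σ_{y in slice} Re tr(ρ(F_b(V)(y))ᴴ ρ(F_b(V')(y)))`. [folklore] -/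
def elGram (JE : ℝ) (i : Fin d) (b : Bool) (V V' : Config d L₀ (2 * n + 2) G) : ℝ :=
  ∑ y : Site d L₀ (2 * n + 2), if y.2 i = bondSlice n b then
    JE * ((star (ρ (feat i V y none b)) * ρ (feat i V' y none b)).trace).re else 0

/-- The magnetic Gram sum (both bonds). [folklore] -/
def magGram (JM : ℝ) (i : Fin d) (V V' : Config d L₀ (2 * n + 2) G) : ℝ :=
  ∑ b : Bool, ∑ y : Site d L₀ (2 * n + 2), if y.2 i = bondSlice n b then
    JM * ∑ p ∈ Finset.univ.filter (fun p : {p : Fin d × Fin d // p.1 < p.2} => ¬(p.1.1 ≠ i ∧ p.1.2 ≠ i)),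
      ((star (ρ (feat i V y (some (otherDir i p)) b)) * ρ (feat i V' y (some (otherDir i p)) b)).trace).re
    else 0

omit [NeZero L₀] in
/-- `√(J/2)² = J/2` in `ℂ` for `J ≥ 0`. [folklore] -/
theorem sqrt_half_mul_self {J : ℝ} (hJ : 0 ≤ J) :
    ((Real.sqrt (J / 2) : ℂ)) * (Real.sqrt (J / 2) : ℂ) = ((J / 2 : ℝ) : ℂ) := by
  rw [← Complex.ofReal_mul, Real.mul_self_sqrt (by linarith)]

omit [NeZero L₀] in
/-- The doubled (entry, conjugate-entry) pairing gives the real part of the trace pairing: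
`Σ_{kl} (√(J/2) A_{kl} · conj(√(J/2) B_{kl}) + √(J/2) conj A_{kl} · conj(√(J/2) conj B_{kl})) = J Re tr(Aᴴ B)`. [folklore] -/
theorem sum_entry_pair_eq {J : ℝ} (hJ : 0 ≤ J) (A B : Matrix (Fin N) (Fin N) ℂ) :
    ∑ q : Fin N × Fin N, ∑ c : Bool,
      (Bool.rec ((Real.sqrt (J / 2) : ℂ) * A q.1 q.2) ((Real.sqrt (J / 2) : ℂ) * conj (A q.1 q.2)) c) *
        conj (Bool.rec ((Real.sqrt (J / 2) : ℂ) * B q.1 q.2) ((Real.sqrt (J / 2) : ℂ) * conj (B q.1 q.2)) c) =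
      ((J * ((star A * B).trace).re : ℝ) : ℂ) := by
  rw [trace_star_mul_eq_sum]
  have hre : ∀ w : ℂ, ((w.re : ℝ) : ℂ) * 2 = w + conj w := fun w => by
    rw [Complex.add_conj]; push_cast; ring
  rw [Complex.re_sum, Complex.ofReal_mul, Complex.ofReal_sum, Finset.mul_sum, Fintype.sum_prod_type]
  refine Finset.sum_congr rfl fun k _ => ?_
  rw [Complex.re_sum, Complex.ofReal_sum, Finset.mul_sum]
  refine Finset.sum_congr rfl fun l _ => ?_
  rw [Fintype.sum_bool]
  simp only [map_mul, Complex.conj_ofReal, Complex.conj_conj]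
  have h2 := hre (conj (A k l) * B k l)
  rw [map_mul, Complex.conj_conj] at h2
  have hs := sqrt_half_mul_self hJ
  push_cast at hs
  linear_combination (-((Real.sqrt (J / 2) : ℂ) * (Real.sqrt (J / 2) : ℂ))) * h2 +
    (2 * ((conj (A k l) * B k l).re : ℂ)) * hs

/-- **The electric Gram sum as a sum over the family**: `Σ_I aEl_I(V) conj(aEl_I(V')) = elGram(V, V')`. [folklore] -/
theorem sum_aEl_mul_conj {JE : ℝ} (hJE : 0 ≤ JE) (i : Fin d) (b : Bool) (V V' : Config d L₀ (2 * n + 2) G) :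
    ∑ I, aEl ρ JE i b I V * conj (aEl ρ JE i b I V') = ((elGram ρ JE i b V V' : ℝ) : ℂ) := by
  unfold elGram
  rw [Complex.ofReal_sum, Fintype.sum_prod_type, Fintype.sum_prod_type]
  refine Finset.sum_congr rfl fun y _ => ?_
  by_cases hy : y.2 i = bondSlice n b
  · rw [if_pos hy, ← sum_entry_pair_eq hJE]
    refine Finset.sum_congr rfl fun q _ => Finset.sum_congr rfl fun c _ => ?_
    cases c <;> simp [aEl, hy]
  · rw [if_neg hy, Complex.ofReal_zero]
    refine Finset.sum_eq_zero fun q _ => Finset.sum_eq_zero fun c _ => ?_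
    cases c <;> simp [aEl, hy]

/-- **The magnetic Gram sum as a sum over the family.** [folklore] -/
theorem sum_aMag_mul_conj {JM : ℝ} (hJM : 0 ≤ JM) (i : Fin d) (V V' : Config d L₀ (2 * n + 2) G) :
    ∑ I, aMag ρ JM i I V * conj (aMag ρ JM i I V') = ((magGram ρ JM i V V' : ℝ) : ℂ) := by
  unfold magGram
  rw [Complex.ofReal_sum, Fintype.sum_prod_type, Fintype.sum_prod_type]
  refine Finset.sum_congr rfl fun b _ => ?_
  rw [Complex.ofReal_sum, Fintype.sum_prod_type]
  refine Finset.sum_congr rfl fun y _ => ?_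
  rw [Fintype.sum_prod_type]
  by_cases hy : y.2 i = bondSlice n b
  · rw [if_pos hy, Complex.ofReal_mul, Complex.ofReal_sum, Finset.mul_sum, Finset.sum_filter]
    refine Finset.sum_congr rfl fun p _ => ?_
    by_cases hp : ¬(p.1.1 ≠ i ∧ p.1.2 ≠ i)
    · rw [if_pos hp, ← Complex.ofReal_mul, ← sum_entry_pair_eq hJM]
      refine Finset.sum_congr rfl fun q _ => Finset.sum_congr rfl fun c _ => ?_
      cases c <;> simp [aMag, hy, hp]
    · rw [if_neg hp]
      refine Finset.sum_eq_zero fun q _ => Finset.sum_eq_zero fun c _ => ?_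
      cases c <;> simp only [aMag] <;> rw [if_neg (fun h => hp h.2), zero_mul]
  · rw [if_neg hy, Complex.ofReal_zero]
    refine Finset.sum_eq_zero fun p _ => Finset.sum_eq_zero fun q _ => Finset.sum_eq_zero fun c _ => ?_
    cases c <;> simp only [aMag] <;> rw [if_neg (fun h => hy h.1), zero_mul]

/-- **The crossing terms after randomisation are Gram sums**: with `W = mulOn2 Y U`,
`z = splice C (U,Y)`: `crossSlice_0(W) + crossSlice_{n+1}(W) = elGram_0(z,θU) + elGram_1(z,θU) + magGram(z,θU)`.
[folklore] -/
theorem crossSlice_mulOn2_eq_gram (hρu : ∀ g, ρ g ∈ Matrix.unitaryGroup (Fin N) ℂ) (JE JM : ℝ)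
    (i : Fin d) (U Y : Config d L₀ (2 * n + 2) G) :
    crossSlice ρ JE JM i 0 (mulOn2 i Y U) + crossSlice ρ JE JM i ((n + 1 : ℕ) : ZMod (2 * n + 2)) (mulOn2 i Y U) =
      elGram ρ JE i false (splice (bondCross d L₀ n i) (U, Y)) (spaceReflect i U) +
        elGram ρ JE i true (splice (bondCross d L₀ n i) (U, Y)) (spaceReflect i U) +
        magGram ρ JM i (splice (bondCross d L₀ n i) (U, Y)) (spaceReflect i U) := by
  unfold crossSlice elGram magGram
  rw [Fintype.sum_bool]
  have hsplit : ∀ (j : ZMod (2 * n + 2)) (b : Bool), j = bondSlice n b →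
      (∑ y : Site d L₀ (2 * n + 2), if y.2 i = j then
        (JE * (ρ (plaquette (mulOn2 i Y U) y none (some i))).trace.re +
          JM * ∑ p ∈ Finset.univ.filter (fun p : {p : Fin d × Fin d // p.1 < p.2} => ¬(p.1.1 ≠ i ∧ p.1.2 ≠ i)),
            (ρ (plaquette (mulOn2 i Y U) y (some p.1.1) (some p.1.2))).trace.re) else 0) =
      (∑ y : Site d L₀ (2 * n + 2), if y.2 i = j then
        JE * ((star (ρ (feat i (splice (bondCross d L₀ n i) (U, Y)) y none b)) *
          ρ (feat i (spaceReflect i U) y none b)).trace).re else 0) +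
      (∑ y : Site d L₀ (2 * n + 2), if y.2 i = j then
        JM * ∑ p ∈ Finset.univ.filter (fun p : {p : Fin d × Fin d // p.1 < p.2} => ¬(p.1.1 ≠ i ∧ p.1.2 ≠ i)),
          ((star (ρ (feat i (splice (bondCross d L₀ n i) (U, Y)) y (some (otherDir i p)) b)) *
            ρ (feat i (spaceReflect i U) y (some (otherDir i p)) b)).trace).re else 0) := by
    intro j b hj
    rw [← Finset.sum_add_distrib]
    refine Finset.sum_congr rfl fun y _ => ?_
    by_cases hy : y.2 i = j
    · rw [if_pos hy, if_pos hy, if_pos hy, re_trace_plaquette_mulOn2_elec ρ hρu i U Y b (hy.trans hj)]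
      congr 2
      refine Finset.sum_congr rfl fun p hp => ?_
      rw [re_trace_plaquette_mulOn2_mag ρ hρu i U Y b (hy.trans hj) (Finset.mem_filter.1 hp).2]
    · rw [if_neg hy, if_neg hy, if_neg hy, add_zero]
  rw [hsplit 0 false rfl, hsplit ((n + 1 : ℕ) : ZMod (2 * n + 2)) true rfl]
  ring

end Cross2

section WeightIdentity

variable {d L₀ n : ℕ} [NeZero L₀] {G : Type*} [Group G] {N : ℕ}
variable (ρ : G →* Matrix (Fin N) (Fin N) ℂ)

/-- Randomising the crossing links does not change the positive-side exponent. [folklore] -/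
theorem bondPosExp_mulOn2 (JE JM : ℝ) (i : Fin d) (Y U : Config d L₀ (2 * n + 2) G) :
    bondPosExp ρ JE JM i (mulOn2 i Y U) = bondPosExp ρ JE JM i U := by
  refine dependsOn_bondPosExp' ρ JE JM i fun e he => ?_
  have he' := mem_bondPos.1 (Finset.mem_coe.1 he)
  refine mulOn2_apply_of_not_mem Y U (fun h => he'.2 ?_) (fun h => he'.2 ?_)
  · exact ⟨(mem_cross0.1 h).1, Or.inl (mem_cross0.1 h).2⟩
  · exact ⟨(mem_cross1.1 h).1, Or.inr (mem_cross1.1 h).2⟩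

/-- The spliced configuration agrees with `U` on the positive block. [folklore] -/
theorem bondPosExp_splice (JE JM : ℝ) (i : Fin d) (U Y : Config d L₀ (2 * n + 2) G) :
    bondPosExp ρ JE JM i (splice (bondCross d L₀ n i) (U, Y)) = bondPosExp ρ JE JM i U := by
  refine dependsOn_bondPosExp' ρ JE JM i fun e he => ?_
  have he' := mem_bondPos.1 (Finset.mem_coe.1 he)
  rw [splice_apply, if_neg (fun h => he'.2 (mem_bondCross.1 h))]

/-- Reflecting the randomised configuration agrees with reflecting `U` on the positive block (the
reflected positive links are negative non-crossing links, which are not randomised). [folklore] -/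
theorem spaceReflect_mulOn2_apply_of_mem_bondPos (i : Fin d) (Y U : Config d L₀ (2 * n + 2) G)
    {e : Site d L₀ (2 * n + 2) × Dir d} (he : e ∈ bondPos d L₀ n i) :
    spaceReflect i (mulOn2 i Y U) e = spaceReflect i U e := by
  rcases e with ⟨⟨t, x⟩, μ⟩
  have he' := mem_bondPos.1 he
  dsimp only at he'
  by_cases hμ : μ = some i
  · subst hμ
    rw [spaceReflect_same, spaceReflect_same]
    congr 1
    refine mulOn2_apply_of_not_mem Y U (fun h => ?_) (fun h => ?_)
    · have h0 := (mem_cross0.1 h).2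
      dsimp only at h0
      rw [siteRefl_apply_same, neg_eq_zero] at h0
      exact he'.2 ⟨rfl, Or.inl h0⟩
    · have h1 := (mem_cross1.1 h).2
      dsimp only at h1
      rw [siteRefl_apply_same, neg_eq_iff_eq_neg, neg_half] at h1
      exact he'.2 ⟨rfl, Or.inr h1⟩
  · rw [spaceReflect_apply_of_ne i _ (t, x) hμ, spaceReflect_apply_of_ne i U (t, x) hμ]
    exact mulOn2_apply_of_ne Y U _ hμ

/-- Hence the reflected positive-side exponents agree. [folklore] -/
theorem bondPosExp_spaceReflect_mulOn2 (JE JM : ℝ) (i : Fin d) (Y U : Config d L₀ (2 * n + 2) G) :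
    bondPosExp ρ JE JM i (spaceReflect i (mulOn2 i Y U)) = bondPosExp ρ JE JM i (spaceReflect i U) :=
  dependsOn_bondPosExp' ρ JE JM i fun _ he =>
    spaceReflect_mulOn2_apply_of_mem_bondPos i Y U (Finset.mem_coe.1 he)

/-- **The Wilson weight after randomisation of the crossing links** (unitary `ρ`): with
`W = mulOn2 Y U` and `z = splice C (U, Y)`,
`e^{−S(W)} = e^{A(z)} e^{A(θU)} e^{elGram₀(z,θU)} e^{elGram₁(z,θU)} e^{magGram(z,θU)}`. [folklore] -/
theorem weight_mulOn2 (hρu : ∀ g, ρ g ∈ Matrix.unitaryGroup (Fin N) ℂ) (JE JM : ℝ) (i : Fin d)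
    (U Y : Config d L₀ (2 * n + 2) G) :
    weight ρ JE JM (mulOn2 i Y U) =
      Real.exp (bondPosExp ρ JE JM i (splice (bondCross d L₀ n i) (U, Y))) *
        Real.exp (bondPosExp ρ JE JM i (spaceReflect i U)) *
        Real.exp (elGram ρ JE i false (splice (bondCross d L₀ n i) (U, Y)) (spaceReflect i U)) *
        Real.exp (elGram ρ JE i true (splice (bondCross d L₀ n i) (U, Y)) (spaceReflect i U)) *
        Real.exp (magGram ρ JM i (splice (bondCross d L₀ n i) (U, Y)) (spaceReflect i U)) := by
  rw [weight, minusAction_eq_bondPosExp ρ hρu JE JM i, bondPosExp_mulOn2, bondPosExp_spaceReflect_mulOn2,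
    add_assoc, crossSlice_mulOn2_eq_gram ρ hρu, ← bondPosExp_splice ρ JE JM i U Y]
  simp only [Real.exp_add]
  ring

end WeightIdentity

open Literature.MathematicalPhysics.QuantumFieldTheory (haarProbability)
open Literature.MathematicalPhysics.QuantumLattice

section FamilyProps

variable {d L₀ n : ℕ} [NeZero L₀] {G : Type*} [Group G] {N : ℕ}
variable (ρ : G →* Matrix (Fin N) (Fin N) ℂ)

/-- The other direction of a pair containing `i` is not `i`. [folklore] -/
theorem otherDir_ne (i : Fin d) (p : {p : Fin d × Fin d // p.1 < p.2}) : otherDir i p ≠ i := by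
  unfold otherDir
  by_cases h1 : p.1.1 = i
  · rw [if_pos h1]
    intro h2; have := p.2; rw [h1, h2] at this; exact lt_irrefl _ this
  · rw [if_neg h1]; exact h1

/-- `(−(n+2)).val = n` in `ℤ_{2n+2}` (the slice `n + 2 = −n` is in the half `A`). [folklore] -/
theorem val_neg_half_add_one : (-(((n + 1 : ℕ) : ZMod (2 * n + 2)) + 1)).val = n := by
  have : (-(((n + 1 : ℕ) : ZMod (2 * n + 2)) + 1)) = ((n : ℕ) : ZMod (2 * n + 2)) := by
    have h := ZMod.natCast_self (2 * n + 2)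
    push_cast at h ⊢
    linear_combination (-1 : ZMod (2 * n + 2)) * h
  rw [this, val_natCast_of_le (by omega)]

/-- **The features read only `P ∪ C`.** [folklore] -/
theorem dependsOn_feat (i : Fin d) (b : Bool) {y : Site d L₀ (2 * n + 2)} (hy : y.2 i = bondSlice n b)
    {μ : Dir d} (hμ : μ ≠ some i) :
    DependsOn (fun U' : Config d L₀ (2 * n + 2) G => feat i U' y μ b)
      ((bondPos d L₀ n i ∪ bondCross d L₀ n i : Finset _) : Set _) := by
  intro U V hUV
  have hC : ∀ e ∈ bondCross d L₀ n i, U e = V e := fun e he =>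
    hUV e (Finset.mem_coe.2 (Finset.mem_union_right _ he))
  have hP : ∀ e ∈ bondPos d L₀ n i, U e = V e := fun e he =>
    hUV e (Finset.mem_coe.2 (Finset.mem_union_left _ he))
  cases b with
  | false =>
      simp only [feat, featM]
      simp only [bondSlice] at hy
      rw [hC _ (mem_bondCross.2 ⟨rfl, Or.inl hy⟩), hP _ (mem_bondPos_of_ne hμ (by rw [hy]; simp)),
        hC _ (mem_bondCross.2 ⟨rfl, Or.inl (by rw [shift_apply_dir_of_ne y i hμ, hy])⟩)]
  | true =>
      simp only [feat, featN]
      simp only [bondSlice] at hy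
      have hs : (y.shift (some i)).2 i = ((n + 1 : ℕ) : ZMod (2 * n + 2)) + 1 := by simp [Site.shift, hy]
      rw [hC _ (mem_bondCross.2 ⟨rfl, Or.inr hy⟩), hP _ (mem_bondPos_of_ne hμ (by rw [hs, val_neg_half_add_one])),
        hC _ (mem_bondCross.2 ⟨rfl, Or.inr (by rw [shift_apply_dir_of_ne y i hμ, hy])⟩)]

/-- The electric family depends only on `P ∪ C`. [folklore] -/
theorem dependsOn_aEl (JE : ℝ) (i : Fin d) (b : Bool) (I : (Site d L₀ (2 * n + 2) × Fin N × Fin N) × Bool) :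
    DependsOn (aEl ρ JE i b I : Config d L₀ (2 * n + 2) G → ℂ)
      ((bondPos d L₀ n i ∪ bondCross d L₀ n i : Finset _) : Set _) := by
  intro U V hUV
  rcases I with ⟨⟨y, k, l⟩, c⟩
  by_cases hy : y.2 i = bondSlice n b
  · have h := dependsOn_feat i b hy (μ := none) (by simp) hUV
    cases c <;> simp only [aEl, if_pos hy] <;> simp only at h <;> rw [h]
  · cases c <;> simp only [aEl, if_neg hy]

/-- The magnetic family depends only on `P ∪ C`. [folklore] -/
theorem dependsOn_aMag (JM : ℝ) (i : Fin d)
    (I : (Bool × Site d L₀ (2 * n + 2) × {p : Fin d × Fin d // p.1 < p.2} × Fin N × Fin N) × Bool) :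
    DependsOn (aMag ρ JM i I : Config d L₀ (2 * n + 2) G → ℂ)
      ((bondPos d L₀ n i ∪ bondCross d L₀ n i : Finset _) : Set _) := by
  intro U V hUV
  rcases I with ⟨⟨b, y, p, k, l⟩, c⟩
  by_cases hy : y.2 i = bondSlice n b ∧ ¬(p.1.1 ≠ i ∧ p.1.2 ≠ i)
  · have h := dependsOn_feat i b hy.1 (μ := some (otherDir i p)) (by simpa using otherDir_ne i p) hUV
    cases c <;> simp only [aMag, if_pos hy] <;> simp only at h <;> rw [h]
  · cases c <;> simp only [aMag, if_neg hy]

omit [NeZero L₀] in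
/-- The features are unitary... rather: their images under a unitary representation are. [folklore] -/
theorem rep_feat_mem_unitaryGroup (hρu : ∀ g, ρ g ∈ Matrix.unitaryGroup (Fin N) ℂ) (i : Fin d)
    (U' : Config d L₀ (2 * n + 2) G) (y : Site d L₀ (2 * n + 2)) (μ : Dir d) (b : Bool) :
    ρ (feat i U' y μ b) ∈ Matrix.unitaryGroup (Fin N) ℂ := hρu _

omit [NeZero L₀] in
/-- **Uniform bound for the electric family**: `‖aEl_I‖ ≤ √(J_E/2)`. [folklore] -/
theorem norm_aEl_le (hρu : ∀ g, ρ g ∈ Matrix.unitaryGroup (Fin N) ℂ) (JE : ℝ) (i : Fin d) (b : Bool)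
    (I : (Site d L₀ (2 * n + 2) × Fin N × Fin N) × Bool) (U' : Config d L₀ (2 * n + 2) G) :
    ‖aEl ρ JE i b I U'‖ ≤ Real.sqrt (JE / 2) := by
  rcases I with ⟨⟨y, k, l⟩, c⟩
  have h1 : ‖(Real.sqrt (JE / 2) : ℂ)‖ = Real.sqrt (JE / 2) := by
    rw [Complex.norm_real, Real.norm_of_nonneg (Real.sqrt_nonneg _)]
  have he : ‖ρ (feat i U' y none b) k l‖ ≤ 1 := entry_norm_bound_of_unitary (hρu _) k l
  cases c <;> simp only [aEl] <;> split_ifs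
  · rw [norm_mul, h1]; exact mul_le_of_le_one_right (Real.sqrt_nonneg _) he
  · rw [norm_zero]; exact Real.sqrt_nonneg _
  · rw [norm_mul, h1, Complex.norm_conj]; exact mul_le_of_le_one_right (Real.sqrt_nonneg _) he
  · rw [norm_zero]; exact Real.sqrt_nonneg _

omit [NeZero L₀] in
/-- **Uniform bound for the magnetic family**: `‖aMag_I‖ ≤ √(J_M/2)`. [folklore] -/
theorem norm_aMag_le (hρu : ∀ g, ρ g ∈ Matrix.unitaryGroup (Fin N) ℂ) (JM : ℝ) (i : Fin d)
    (I : (Bool × Site d L₀ (2 * n + 2) × {p : Fin d × Fin d // p.1 < p.2} × Fin N × Fin N) × Bool)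
    (U' : Config d L₀ (2 * n + 2) G) : ‖aMag ρ JM i I U'‖ ≤ Real.sqrt (JM / 2) := by
  rcases I with ⟨⟨b, y, p, k, l⟩, c⟩
  have h1 : ‖(Real.sqrt (JM / 2) : ℂ)‖ = Real.sqrt (JM / 2) := by
    rw [Complex.norm_real, Real.norm_of_nonneg (Real.sqrt_nonneg _)]
  have he : ‖ρ (feat i U' y (some (otherDir i p)) b) k l‖ ≤ 1 := entry_norm_bound_of_unitary (hρu _) k l
  cases c <;> simp only [aMag] <;> split_ifs
  · rw [norm_mul, h1]; exact mul_le_of_le_one_right (Real.sqrt_nonneg _) he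
  · rw [norm_zero]; exact Real.sqrt_nonneg _
  · rw [norm_mul, h1, Complex.norm_conj]; exact mul_le_of_le_one_right (Real.sqrt_nonneg _) he
  · rw [norm_zero]; exact Real.sqrt_nonneg _

variable [TopologicalSpace G] [IsTopologicalGroup G]

omit [NeZero L₀] in
/-- The features are continuous in the configuration (continuous `ρ` not needed). [folklore] -/
theorem continuous_feat {L : ℕ} (i : Fin d) (y : Site d L₀ L) (μ : Dir d) (b : Bool) :
    Continuous fun U' : Config d L₀ L G => feat i U' y μ b := by
  cases b with
  | false =>
      simp only [feat, featM]
      fun_prop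
  | true =>
      simp only [feat, featN]
      fun_prop

omit [NeZero L₀] in
/-- The electric family is continuous (for continuous `ρ`). [folklore] -/
theorem continuous_aEl (hρ : Continuous ρ) (JE : ℝ) (i : Fin d) (b : Bool)
    (I : (Site d L₀ (2 * n + 2) × Fin N × Fin N) × Bool) :
    Continuous (aEl ρ JE i b I : Config d L₀ (2 * n + 2) G → ℂ) := by
  rcases I with ⟨⟨y, k, l⟩, c⟩
  have h : Continuous fun U' : Config d L₀ (2 * n + 2) G => ρ (feat i U' y none b) k l :=
    (hρ.comp (continuous_feat i y none b)).matrix_elem k l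
  cases c <;> simp only [aEl] <;> split_ifs
  · exact continuous_const.mul h
  · exact continuous_const
  · exact continuous_const.mul (Complex.continuous_conj.comp h)
  · exact continuous_const

omit [NeZero L₀] in
/-- The magnetic family is continuous (for continuous `ρ`). [folklore] -/
theorem continuous_aMag (hρ : Continuous ρ) (JM : ℝ) (i : Fin d)
    (I : (Bool × Site d L₀ (2 * n + 2) × {p : Fin d × Fin d // p.1 < p.2} × Fin N × Fin N) × Bool) :
    Continuous (aMag ρ JM i I : Config d L₀ (2 * n + 2) G → ℂ) := by
  rcases I with ⟨⟨b, y, p, k, l⟩, c⟩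
  have h : Continuous fun U' : Config d L₀ (2 * n + 2) G => ρ (feat i U' y (some (otherDir i p)) b) k l :=
    (hρ.comp (continuous_feat i y _ b)).matrix_elem k l
  cases c <;> simp only [aMag] <;> split_ifs
  · exact continuous_const.mul h
  · exact continuous_const
  · exact continuous_const.mul (Complex.continuous_conj.comp h)
  · exact continuous_const

omit [NeZero L₀] in
/-- Slice sums are continuous (for continuous `ρ`). [folklore] -/
theorem continuous_inSlice {L : ℕ} [NeZero L₀] [NeZero L] (hρ : Continuous ρ) (JE JM : ℝ) (i : Fin d) (j : ZMod L) :
    Continuous (inSlice ρ JE JM i j : Config d L₀ L G → ℝ) := by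
  unfold inSlice
  refine continuous_finsetSum _ fun y _ => ?_
  split_ifs
  · refine (continuous_const.mul (continuous_finsetSum _ fun k _ => ?_)).add
      (continuous_const.mul (continuous_finsetSum _ fun p _ => ?_))
    · exact Complex.continuous_re.comp (Continuous.matrix_trace (hρ.comp (continuous_plaquette _ _ _)))
    · exact Complex.continuous_re.comp (Continuous.matrix_trace (hρ.comp (continuous_plaquette _ _ _)))
  · exact continuous_const

omit [NeZero L₀] in
/-- Cross-slice sums are continuous (for continuous `ρ`). [folklore] -/
theorem continuous_crossSlice {L : ℕ} [NeZero L₀] [NeZero L] (hρ : Continuous ρ) (JE JM : ℝ) (i : Fin d)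
    (j : ZMod L) : Continuous (crossSlice ρ JE JM i j : Config d L₀ L G → ℝ) := by
  unfold crossSlice
  refine continuous_finsetSum _ fun y _ => ?_
  split_ifs
  · refine (continuous_const.mul ?_).add (continuous_const.mul (continuous_finsetSum _ fun p _ => ?_))
    · exact Complex.continuous_re.comp (Continuous.matrix_trace (hρ.comp (continuous_plaquette _ _ _)))
    · exact Complex.continuous_re.comp (Continuous.matrix_trace (hρ.comp (continuous_plaquette _ _ _)))
  · exact continuous_const

/-- The positive-side exponent of the bond reflection is continuous. [folklore] -/
theorem continuous_bondPosExp (hρ : Continuous ρ) (JE JM : ℝ) (i : Fin d) :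
    Continuous (bondPosExp ρ JE JM i : Config d L₀ (2 * n + 2) G → ℝ) := by
  unfold bondPosExp
  exact (continuous_inSlice ρ hρ JE JM i 0).add (continuous_finsetSum _ fun k _ =>
    (continuous_inSlice ρ hρ JE JM i _).add (continuous_crossSlice ρ hρ JE JM i _))

/-- The positive-side exponent of the site reflection is continuous. [folklore] -/
theorem continuous_sitePosExp (hρ : Continuous ρ) (JE JM : ℝ) (i : Fin d) :
    Continuous (sitePosExp ρ JE JM i : Config d L₀ (2 * n + 2) G → ℝ) := by
  unfold sitePosExp
  exact (continuous_finsetSum _ fun k _ => continuous_inSlice ρ hρ JE JM i _).add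
    (continuous_finsetSum _ fun k _ => continuous_crossSlice ρ hρ JE JM i _)

end FamilyProps

section RP

variable {d L₀ n : ℕ} [NeZero L₀] {G : Type*} [Group G] [TopologicalSpace G] [IsTopologicalGroup G]
  [CompactSpace G] [MeasurableSpace G] [BorelSpace G] [SecondCountableTopology G] {N : ℕ}
variable (ρ : G →* Matrix (Fin N) (Fin N) ℂ)

/-- The combined Gram family of the bond reflection: electric (both bonds) and magnetic. [folklore] -/
def aBond (JE JM : ℝ) (i : Fin d) :
    ((Site d L₀ (2 * n + 2) × Fin N × Fin N) × Bool) ⊕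
      (((Site d L₀ (2 * n + 2) × Fin N × Fin N) × Bool) ⊕
        ((Bool × Site d L₀ (2 * n + 2) × {p : Fin d × Fin d // p.1 < p.2} × Fin N × Fin N) × Bool)) →
      Config d L₀ (2 * n + 2) G → ℂ :=
  Sum.elim (aEl ρ JE i false) (Sum.elim (aEl ρ JE i true) (aMag ρ JM i))

omit [TopologicalSpace G] [IsTopologicalGroup G] [CompactSpace G] [MeasurableSpace G] [BorelSpace G]
  [SecondCountableTopology G] in
/-- The sum over the combined family is the total Gram exponent. [folklore] -/
theorem sum_aBond_mul_conj {JE JM : ℝ} (hJE : 0 ≤ JE) (hJM : 0 ≤ JM) (i : Fin d)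
    (V V' : Config d L₀ (2 * n + 2) G) :
    ∑ I, aBond ρ JE JM i I V * conj (aBond ρ JE JM i I V') =
      ((elGram ρ JE i false V V' + elGram ρ JE i true V V' + magGram ρ JM i V V' : ℝ) : ℂ) := by
  unfold aBond
  rw [Fintype.sum_sum_type, Fintype.sum_sum_type]
  simp only [Sum.elim_inl, Sum.elim_inr]
  rw [sum_aEl_mul_conj ρ hJE, sum_aEl_mul_conj ρ hJE, sum_aMag_mul_conj ρ hJM]
  push_cast
  ring

omit [TopologicalSpace G] [IsTopologicalGroup G] [CompactSpace G] [MeasurableSpace G] [BorelSpace G]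
  [SecondCountableTopology G] in
/-- Observables depending only on the positive block do not see the randomisation. [folklore] -/
theorem apply_mulOn2_of_dependsOn {β : Type*} (i : Fin d) {O : Config d L₀ (2 * n + 2) G → β}
    (hO : DependsOn O ((bondPos d L₀ n i : Finset _) : Set _)) (Y U : Config d L₀ (2 * n + 2) G) :
    O (mulOn2 i Y U) = O U := by
  refine hO fun e he => ?_
  have he' := mem_bondPos.1 (Finset.mem_coe.1 he)
  refine mulOn2_apply_of_not_mem Y U (fun h => he'.2 ?_) (fun h => he'.2 ?_)
  · exact ⟨(mem_cross0.1 h).1, Or.inl (mem_cross0.1 h).2⟩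
  · exact ⟨(mem_cross1.1 h).1, Or.inr (mem_cross1.1 h).2⟩

omit [Group G] [TopologicalSpace G] [IsTopologicalGroup G] [CompactSpace G] [MeasurableSpace G] [BorelSpace G]
  [SecondCountableTopology G] in
/-- Observables depending only on the positive block do not see the splice of the crossing links. [folklore] -/
theorem apply_splice_of_dependsOn {β : Type*} (i : Fin d) {O : Config d L₀ (2 * n + 2) G → β}
    (hO : DependsOn O ((bondPos d L₀ n i : Finset _) : Set _)) (U Y : Config d L₀ (2 * n + 2) G) :
    O (splice (bondCross d L₀ n i) (U, Y)) = O U := by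
  refine hO fun e he => ?_
  have he' := mem_bondPos.1 (Finset.mem_coe.1 he)
  rw [splice_apply, if_neg (fun h => he'.2 (mem_bondCross.1 h))]

omit [TopologicalSpace G] [IsTopologicalGroup G] [CompactSpace G] [MeasurableSpace G] [BorelSpace G]
  [SecondCountableTopology G] in
/-- Observables depending only on the positive block see the same reflection with or without
randomisation. [folklore] -/
theorem apply_spaceReflect_mulOn2_of_dependsOn {β : Type*} (i : Fin d) {O : Config d L₀ (2 * n + 2) G → β}
    (hO : DependsOn O ((bondPos d L₀ n i : Finset _) : Set _)) (Y U : Config d L₀ (2 * n + 2) G) :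
    O (spaceReflect i (mulOn2 i Y U)) = O (spaceReflect i U) :=
  hO fun _ he => spaceReflect_mulOn2_apply_of_mem_bondPos i Y U (Finset.mem_coe.1 he)

/-- **Reflection positivity in a spatial bond plane (even spatial period).** For the
finite-temperature Wilson weight with a continuous unitary representation `ρ` and `J_E, J_M ≥ 0`,
spatial period `L = 2n + 2`, a spatial direction `i`, and every bounded measurable observable `O`
depending only on the links based in the half `{x_i ∈ {0, −1, …, −n}}` (minus the crossing links),
`0 ≤ ∫ O(U) conj(O(θU)) e^{−S(U)} ∏dg`, `θ` the reflection in the hyperplanes `x_i = 1/2`,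
`x_i = (L+1)/2`. ("The general formalism provides such a `𝒯` if the model possesses reflection
positivity with respect to reflection … in planes lying half-way between lattice planes.") [cite: BorgsSeiler1983, §II.2 (pp. 331–332)] -/
theorem integral_mul_conj_spaceReflect_mul_weight_nonneg (hρu : ∀ g, ρ g ∈ Matrix.unitaryGroup (Fin N) ℂ)
    (hρ : Continuous ρ) {JE JM : ℝ} (hJE : 0 ≤ JE) (hJM : 0 ≤ JM) (i : Fin d)
    {O : Config d L₀ (2 * n + 2) G → ℂ} (hOm : Measurable O) {K : ℝ} (hOb : ∀ U, ‖O U‖ ≤ K)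
    (hOdep : DependsOn O ((bondPos d L₀ n i : Finset _) : Set _)) :
    0 ≤ ∫ U, O U * conj (O (spaceReflect i U)) * (weight ρ JE JM U : ℂ) ∂haar d L₀ (2 * n + 2) G := by
  have hθm : Measurable (spaceReflect i : Config d L₀ (2 * n + 2) G → Config d L₀ (2 * n + 2) G) :=
    (continuous_spaceReflect i).measurable
  have hconj : Measurable (starRingEnd ℂ : ℂ → ℂ) := Complex.continuous_conj.measurable
  have hwc := continuous_weight (d := d) (L₀ := L₀) (L := 2 * n + 2) ρ hρ JE JM
  have hFm : Measurable fun U : Config d L₀ (2 * n + 2) G =>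
      O U * conj (O (spaceReflect i U)) * (weight ρ JE JM U : ℂ) :=
    (hOm.mul (hconj.comp (hOm.comp hθm))).mul (Complex.measurable_ofReal.comp hwc.measurable)
  obtain ⟨Kw, hKw⟩ := exists_forall_norm_le_of_continuous (L := 2 * n + 2) hwc
  have hFb : ∀ U : Config d L₀ (2 * n + 2) G,
      ‖O U * conj (O (spaceReflect i U)) * (weight ρ JE JM U : ℂ)‖ ≤ K * K * Kw := by
    intro U
    have hK0 : 0 ≤ K := (norm_nonneg _).trans (hOb U)
    rw [norm_mul, norm_mul, Complex.norm_conj, Complex.norm_real]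
    exact mul_le_mul (mul_le_mul (hOb _) (hOb _) (norm_nonneg _) hK0) (hKw U) (norm_nonneg _)
      (mul_nonneg hK0 hK0)
  rw [integral_eq_integral_prod_mulOn2 i hFm hFb]
  -- the observable of the abstract theorem
  set g : Config d L₀ (2 * n + 2) G → ℂ := fun V => O V * (Real.exp (bondPosExp ρ JE JM i V) : ℂ) with hg
  have hpt : ∀ p : Config d L₀ (2 * n + 2) G × Config d L₀ (2 * n + 2) G,
      O (mulOn2 i p.2 p.1) * conj (O (spaceReflect i (mulOn2 i p.2 p.1))) *
          (weight ρ JE JM (mulOn2 i p.2 p.1) : ℂ) =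
        g (splice (bondCross d L₀ n i) p) * conj (g (spaceReflect i p.1)) *
          Complex.exp (∑ I, aBond ρ JE JM i I (splice (bondCross d L₀ n i) p) *
            conj (aBond ρ JE JM i I (spaceReflect i p.1))) := by
    rintro ⟨U, Y⟩
    simp only [hg]
    rw [apply_mulOn2_of_dependsOn i hOdep, apply_spaceReflect_mulOn2_of_dependsOn i hOdep,
      weight_mulOn2 ρ hρu, sum_aBond_mul_conj ρ hJE hJM, apply_splice_of_dependsOn i hOdep,
      Complex.ofReal_exp]
    simp only [map_mul, Complex.conj_ofReal]
    push_cast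
    simp only [Complex.exp_add]
    ring
  simp_rw [hpt]
  -- hypotheses of the abstract theorem
  have hgm : Measurable g :=
    hOm.mul (Complex.measurable_ofReal.comp ((Real.continuous_exp.comp
      (continuous_bondPosExp ρ hρ JE JM i)).measurable))
  obtain ⟨Kb, hKb⟩ := exists_forall_norm_le_of_continuous (L := 2 * n + 2)
    (Real.continuous_exp.comp (continuous_bondPosExp (d := d) (L₀ := L₀) (n := n) ρ hρ JE JM i))
  have hgb : ∀ U, ‖g U‖ ≤ K * Kb := fun U => by
    simp only [hg]
    rw [norm_mul, Complex.norm_real]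
    exact mul_le_mul (hOb U) (hKb U) (norm_nonneg _) ((norm_nonneg _).trans (hOb U))
  have hgdep : DependsOn g ((bondPos d L₀ n i ∪ bondCross d L₀ n i : Finset _) : Set _) := by
    intro U V hUV
    have h1 : O U = O V := hOdep fun e he =>
      hUV e (Finset.mem_coe.2 (Finset.mem_union_left _ (Finset.mem_coe.1 he)))
    have h2 := dependsOn_bondPosExp ρ JE JM i hUV
    simp only [hg]
    rw [h1, h2]
  exact Literature.MathematicalPhysics.QuantumFieldTheory.LatticeRP.integral_mul_conj_mul_exp_nonneg
    (haarProbability G) (bondPos d L₀ n i) (bondCross d L₀ n i) (spaceReflect i)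
    (measurePreserving_spaceReflect i) (fun e he => dependsOn_spaceReflect_apply he) hgm
    (fun I => by
      rcases I with I | I | I
      · exact (continuous_aEl ρ hρ JE i false I).measurable
      · exact (continuous_aEl ρ hρ JE i true I).measurable
      · exact (continuous_aMag ρ hρ JM i I).measurable)
    hgb (Ka := max (Real.sqrt (JE / 2)) (Real.sqrt (JM / 2)))
    (fun I U => by
      rcases I with I | I | I
      · exact (norm_aEl_le ρ hρu JE i false I U).trans (le_max_left _ _)
      · exact (norm_aEl_le ρ hρu JE i true I U).trans (le_max_left _ _)
      · exact (norm_aMag_le ρ hρu JM i I U).trans (le_max_right _ _))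
    hgdep
    (fun I => by
      rcases I with I | I | I
      · exact dependsOn_aEl ρ JE i false I
      · exact dependsOn_aEl ρ JE i true I
      · exact dependsOn_aMag ρ JM i I)

/-- **Reflection positivity in a spatial lattice plane (even spatial period).** For the
finite-temperature Wilson weight with a continuous unitary representation `ρ`, spatial period
`L = 2n + 2` with `n ≥ 1`, a spatial direction `i`, and every bounded measurable observable `O`
depending only on the links based in the closed half `{x_i ∈ {0, −1, …, −(n+1)}}` (the links of the
slices `−1, …, −n`, the direction-`i` links from the slice `n+1`, and the in-plane links of the two
planes `x_i = 0`, `x_i = n + 1`), `0 ≤ ∫ O(U) conj(O(σU)) e^{−S(U)} ∏dg`, `σ` the reflection in the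
lattice hyperplanes `x_i = 0`, `x_i = L/2`. [cite: BorgsSeiler1983, §II.2 (pp. 331–332)] -/
theorem integral_mul_conj_spaceSiteReflect_mul_weight_nonneg (hρu : ∀ g, ρ g ∈ Matrix.unitaryGroup (Fin N) ℂ)
    (hρ : Continuous ρ) (hn : 1 ≤ n) (JE JM : ℝ) (i : Fin d)
    {O : Config d L₀ (2 * n + 2) G → ℂ} (hOm : Measurable O) {K : ℝ} (hOb : ∀ U, ‖O U‖ ≤ K)
    (hOdep : DependsOn O ((sitePos d L₀ n i ∪ ∅ ∪ siteShared d L₀ n i : Finset _) : Set _)) :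
    0 ≤ ∫ U, O U * conj (O (spaceSiteReflect i U)) * (weight ρ JE JM U : ℂ) ∂haar d L₀ (2 * n + 2) G := by
  have hθm : Measurable (spaceSiteReflect i : Config d L₀ (2 * n + 2) G → Config d L₀ (2 * n + 2) G) :=
    (continuous_spaceSiteReflect i).measurable
  have hconj : Measurable (starRingEnd ℂ : ℂ → ℂ) := Complex.continuous_conj.measurable
  have hwc := continuous_weight (d := d) (L₀ := L₀) (L := 2 * n + 2) ρ hρ JE JM
  have hFm : Measurable fun U : Config d L₀ (2 * n + 2) G =>
      O U * conj (O (spaceSiteReflect i U)) * (weight ρ JE JM U : ℂ) :=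
    (hOm.mul (hconj.comp (hOm.comp hθm))).mul (Complex.measurable_ofReal.comp hwc.measurable)
  obtain ⟨Kw, hKw⟩ := exists_forall_norm_le_of_continuous (L := 2 * n + 2) hwc
  have hFb : ∀ U : Config d L₀ (2 * n + 2) G,
      ‖O U * conj (O (spaceSiteReflect i U)) * (weight ρ JE JM U : ℂ)‖ ≤ K * K * Kw := by
    intro U
    have hK0 : 0 ≤ K := (norm_nonneg _).trans (hOb U)
    rw [norm_mul, norm_mul, Complex.norm_conj, Complex.norm_real]
    exact mul_le_mul (mul_le_mul (hOb _) (hOb _) (norm_nonneg _) hK0) (hKw U) (norm_nonneg _)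
      (mul_nonneg hK0 hK0)
  -- pass to the product space with a trivial second factor
  rw [integral_eq_integral_prod_mulOn ∅ hFm hFb]
  simp_rw [mulOn_empty]
  -- the observable of the abstract theorem: `Φ = O e^{A'} e^{(in_0 + in_{n+1})/2}`
  set pl : Config d L₀ (2 * n + 2) G → ℝ := fun V =>
    inSlice ρ JE JM i 0 V + inSlice ρ JE JM i ((n + 1 : ℕ) : ZMod (2 * n + 2)) V with hpl
  set Φ : Config d L₀ (2 * n + 2) G → ℂ := fun V =>
    O V * (Real.exp (sitePosExp ρ JE JM i V) : ℂ) * (Real.exp (pl V / 2) : ℂ) with hΦ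
  have hplσ : ∀ V, pl (spaceSiteReflect i V) = pl V := fun V => by
    simp only [hpl]
    rw [inSlice_plane_spaceSiteReflect ρ JE JM i (Or.inl rfl), inSlice_plane_spaceSiteReflect ρ JE JM i (Or.inr rfl)]
  have hpt : ∀ p : Config d L₀ (2 * n + 2) G × Config d L₀ (2 * n + 2) G,
      O p.1 * conj (O (spaceSiteReflect i p.1)) * (weight ρ JE JM p.1 : ℂ) =
        Φ (splice ∅ p) * conj (Φ (spaceSiteReflect i p.1)) := by
    rintro ⟨U, Y⟩
    rw [splice_empty]
    have hwr : weight ρ JE JM U = Real.exp (sitePosExp ρ JE JM i U) *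
        Real.exp (sitePosExp ρ JE JM i (spaceSiteReflect i U)) * (Real.exp (pl U / 2) * Real.exp (pl U / 2)) := by
      rw [weight, minusAction_eq_sitePosExp ρ hρu JE JM i U, ← Real.exp_add (pl U / 2), add_halves,
        ← Real.exp_add, ← Real.exp_add]
      simp only [hpl]
      ring_nf
    simp only [hΦ]
    rw [hwr, hplσ]
    simp only [Complex.ofReal_mul, map_mul, Complex.conj_ofReal]
    ring
  simp_rw [hpt]
  -- hypotheses of the abstract theorem
  have hplc : Continuous pl := (continuous_inSlice ρ hρ JE JM i 0).add (continuous_inSlice ρ hρ JE JM i _)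
  have hΦm : Measurable Φ :=
    (hOm.mul (Complex.measurable_ofReal.comp ((Real.continuous_exp.comp
      (continuous_sitePosExp ρ hρ JE JM i)).measurable))).mul
      (Complex.measurable_ofReal.comp ((Real.continuous_exp.comp (hplc.div_const 2)).measurable))
  obtain ⟨K1, hK1⟩ := exists_forall_norm_le_of_continuous (L := 2 * n + 2)
    (Real.continuous_exp.comp (continuous_sitePosExp (d := d) (L₀ := L₀) (n := n) ρ hρ JE JM i))
  obtain ⟨K2, hK2⟩ := exists_forall_norm_le_of_continuous (L := 2 * n + 2)
    (Real.continuous_exp.comp (hplc.div_const 2))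
  have hΦb : ∀ U, ‖Φ U‖ ≤ K * K1 * K2 := fun U => by
    simp only [hΦ]
    rw [norm_mul, norm_mul, Complex.norm_real, Complex.norm_real]
    have hK0 : 0 ≤ K := (norm_nonneg _).trans (hOb U)
    exact mul_le_mul (mul_le_mul (hOb U) (hK1 U) (norm_nonneg _) hK0) (hK2 U) (norm_nonneg _)
      (mul_nonneg hK0 ((norm_nonneg _).trans (hK1 U)))
  have hΦdep : DependsOn Φ ((sitePos d L₀ n i ∪ ∅ ∪ siteShared d L₀ n i : Finset _) : Set _) := by
    intro U V hUV
    have h1 : O U = O V := hOdep hUV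
    have h2 := dependsOn_sitePosExp ρ JE JM i hUV
    have h3 := dependsOn_inSlice_plane ρ JE JM i (j := 0) (Or.inl rfl) hUV
    have h4 := dependsOn_inSlice_plane ρ JE JM i (j := ((n + 1 : ℕ) : ZMod (2 * n + 2))) (Or.inr rfl) hUV
    simp only [hΦ, hpl]
    rw [h1, h2, h3, h4]
  exact Literature.MathematicalPhysics.QuantumFieldTheory.LatticeRP.integral_splice_mul_conj_comp_of_shared_nonneg
    (haarProbability G) (siteShared d L₀ n i) (sitePos d L₀ n i) ∅ (spaceSiteReflect i)
    (measurePreserving_spaceSiteReflect i) (fun U e he => spaceSiteReflect_apply_of_mem_siteShared U he)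
    (fun e he => dependsOn_spaceSiteReflect_apply hn he) (disjoint_siteShared_sitePos i)
    (Finset.disjoint_empty_right _) hΦm hΦb hΦdep

end RP


end FiniteTemperature

end Literature.Barriers.QuantumFields

end
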